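import Summits.AnomalousDissipation.AnomalousDissipation.Theorems.DenseLoudDesignerForces.Negative.Scaling

/-!
# Negative knowledge for the crux `DenseLoudDesignerForces` (stmt-AnomalousDissipation-1143), IX: stock enlargement

Certified copy of §11 of the cdisprove work file: the zero extension `ι : P_S → P_{S'}` (`S ⊆ S'`) does not
change the force (`force_extendCoeff`), loud sets are compatible (`mem_loudSet_extend_iff`), and the range of
`ι` contains no non-empty open set once `S'` has a mode outside `S` (`not_subset_range_extendCoeff`): windows do
not push forward, so the hedge `∀ S₀ ∃ S ⊇ S₀` is genuinely stronger than `∃ S`.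
Supports stmt-AnomalousDissipation-1143.
-/

noncomputable section

namespace Summit.AnomalousDissipation.AnomalousDissipation.Theorems.DenseLoudDesignerForces.Negative

open scoped BigOperators Topology ENNReal InnerProductSpace
open Filter Set MeasureTheory UnitAddTorus
open Literature.Analysis.FunctionSpaces Literature.Analysis.FluidPDE
open Summit.AnomalousDissipation.AnomalousDissipation.Theses.BaireTransfer

/-! ## §11 Stock enlargement: loud sets are compatible, windows do not transfer

For `S ⊆ S'` the extension-by-zero `ι : P_S → P_{S'}` satisfies `f_{ι c} = f_c`, hence
`c ∈ LOUD_j(S,E,ε) ↔ ι c ∈ LOUD_j(S',E,ε)` (`mem_loudSet_extend_iff`).  But the range of `ι` contains no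
non-empty open set when `S ⊊ S'` (`not_subset_range_extendCoeff`), so a WINDOW over `S` is not a window over
`S'`: the hedge `∀ S₀ ∃ S ⊇ S₀` of the crux is genuinely stronger than `∃ S` — enlarging the stock requires
loudness to survive switching on small coefficients at the new modes, an OPENNESS property (the business of
crux #3, RobustLoudUpgrade). -/

section Stock

variable {S : Finset (Fin 3 → ℤ)}

/-- Extension by zero of a coefficient vector from the stock `S` to another stock `S'`. -/
def extendCoeff (S' : Finset (Fin 3 → ℤ)) (c : ↥S → (EuclideanSpace ℂ (Fin 3))) : ↥S' → (EuclideanSpace ℂ (Fin 3)) :=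
  fun k => if h : (k : Fin 3 → ℤ) ∈ S then c ⟨k, h⟩ else 0

/-- At a mode outside `S` the extension vanishes. -/
theorem extendCoeff_apply_of_not_mem (S' : Finset (Fin 3 → ℤ)) (c : ↥S → (EuclideanSpace ℂ (Fin 3))) {k : ↥S'}
    (hk : (k : Fin 3 → ℤ) ∉ S) : extendCoeff S' c k = 0 := by
  unfold extendCoeff; rw [dif_neg hk]

/-- The zero extensions to `ℤ³` agree when `S ⊆ S'`. -/
theorem coeffExt_extendCoeff {S' : Finset (Fin 3 → ℤ)} (hSS' : S ⊆ S') (c : ↥S → (EuclideanSpace ℂ (Fin 3))) :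
    Torus.coeffExt S' (extendCoeff S' c) = Torus.coeffExt S c := by
  funext k
  by_cases hk' : k ∈ S'
  · rw [Torus.coeffExt_of_mem _ hk']
    unfold extendCoeff
    by_cases hk : k ∈ S
    · rw [dif_pos hk, Torus.coeffExt_of_mem _ hk]
    · rw [dif_neg hk, Torus.coeffExt_of_not_mem _ hk]
  · rw [Torus.coeffExt_of_not_mem _ hk', Torus.coeffExt_of_not_mem _ (fun hk => hk' (hSS' hk))]

/-- ENLARGING THE STOCK DOES NOT CHANGE THE FORCE: `f_{ι c} = f_c` (`S ⊆ S'`). -/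
theorem force_extendCoeff {S' : Finset (Fin 3 → ℤ)} (hSS' : S ⊆ S') (c : ↥S → (EuclideanSpace ℂ (Fin 3))) :
    force S' (extendCoeff S' c) = force S c := by
  unfold force
  rw [coeffExt_extendCoeff hSS', Torus.realTrigPoly_eq_comp, Torus.realTrigPoly_eq_comp,
    Torus.trigPoly_subset hSS' (fun k _ hkS => by
      rw [Torus.coeffExt_of_not_mem _ hkS]
      by_cases hk : k = 0
      · subst hk; simp
      · rw [Torus.lerayCoeff_of_ne_zero hk, Torus.leraySym_zero])]

/-- LOUD SETS ARE COMPATIBLE UNDER STOCK ENLARGEMENT: `ι c ∈ LOUD_j(S') ↔ c ∈ LOUD_j(S)` (`S ⊆ S'`). -/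
theorem mem_loudSet_extend_iff {S' : Finset (Fin 3 → ℤ)} (hSS' : S ⊆ S') {E ε : ℝ} {j : ℕ} (c : ↥S → (EuclideanSpace ℂ (Fin 3))) :
    extendCoeff S' c ∈ loudSet S' E ε j ↔ c ∈ loudSet S E ε j := by
  simp only [loudSet, mem_setOf_eq, force_extendCoeff hSS']

/-- WINDOWS DO NOT TRANSFER: if `S'` has a mode `k₀ ∉ S`, no non-empty open subset of `P_{S'}` lies in the
range of the extension map (its range is killed by the coordinate `c' ↦ c' k₀`). -/
theorem not_subset_range_extendCoeff {S' : Finset (Fin 3 → ℤ)} {k₀ : Fin 3 → ℤ} (hk₀ : k₀ ∈ S') (hk₀S : k₀ ∉ S)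
    {U : Set (↥S' → (EuclideanSpace ℂ (Fin 3)))} (hU : IsOpen U) (hne : U.Nonempty) :
    ¬ U ⊆ Set.range (extendCoeff (S := S) S') := by
  intro hsub
  obtain ⟨c, hc⟩ := hne
  have hzero : ∀ c' ∈ U, c' ⟨k₀, hk₀⟩ = 0 := by
    intro c' hc'
    obtain ⟨c₀, rfl⟩ := hsub hc'
    exact extendCoeff_apply_of_not_mem S' c₀ hk₀S
  -- move `c` along the new coordinate: `t ↦ c + t • e`, `e = single k₀ v`, `v ≠ 0`
  set v : (EuclideanSpace ℂ (Fin 3)) := EuclideanSpace.single 0 (1 : ℂ) with hv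
  have hv0 : v ≠ 0 := by
    rw [hv]; intro h
    have := congr_fun (congrArg (⇑) h) 0
    simp at this
  set e : ↥S' → (EuclideanSpace ℂ (Fin 3)) := Pi.single ⟨k₀, hk₀⟩ v with he
  have hcont : Continuous fun t : ℝ => c + t • e := continuous_const.add (continuous_id.smul continuous_const)
  have hev : ∀ᶠ t : ℝ in 𝓝 0, c + t • e ∈ U := by
    have : Tendsto (fun t : ℝ => c + t • e) (𝓝 0) (𝓝 c) := by
      simpa using hcont.tendsto 0
    exact this (hU.mem_nhds hc)
  obtain ⟨t, ht, htne⟩ := ((hev.filter_mono nhdsWithin_le_nhds).and (self_mem_nhdsWithin (s := {(0 : ℝ)}ᶜ))).exists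
  have h1 := hzero _ ht
  have h0 := hzero c hc
  simp only [Pi.add_apply, Pi.smul_apply, he, Pi.single_eq_same, h0, zero_add] at h1
  exact hv0 ((smul_eq_zero.1 h1).resolve_left htne)

end Stock

end Summit.AnomalousDissipation.AnomalousDissipation.Theorems.DenseLoudDesignerForces.Negative

end
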